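import Summits.CriticalPhenomena.PercolationContinuityZ3.Theorems.PercNearOneGluingNoHeavyLowerTailIncStarTwoCutNearReal
import Summits.CriticalPhenomena.PercolationContinuityZ3.Theorems.PercNearOneGluingNoHeavyLowerTailIncStarTwoCutNearPos
import Summits.CriticalPhenomena.PercolationContinuityZ3.Theorems.PercNearOneGluingNoHeavyLowerTailIncStarTwoCutNearRowsSets
import Literature.Probability.LatticeModels.ProdBernoulliIndependence
import HarnessLib

/-!
# Two-cuts with the root and one target on the root side (MODE B), VI: the near lemma — the four Harris rows, assembled

Support file for the Sahi programme (`--supports stmt-CriticalPhenomena-4575`, prover prim-sahi-p2 gen 26).  No definitions, no named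
facts, no sorries; standard axioms.  Memo `run/shared/lean/prim/prim-sahi/FROM-prim-sahi-p2-gen26-NEAR-LEMMA.md` §3.

Bond percolation `μ = prodBernoulli w` on a finite vertex type; root `s`, ports `x, y`, target `a` (the near side of a mode-B two-cut).
Events: `X̂ = {s↔x}`, `Ŷ = {s↔y}`, `A = {s↔a}`, `D_x = {x↮s} ∩ {x↮y}`, `E_x = D_x ∩ {x↔a}`, `D_y, E_y` (mirror),
`D₀ = {x, y, s pairwise separated}`.  For every increasing event `J ⊆ X̂ ∪ Ŷ` satisfying the two OFF-CLUSTER inequalities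
`μ(D_x)·μ(E_x ∩ J) ≤ μ(E_x)·μ(D_x ∩ J)` and its mirror (for `J ∈ {X̂, Ŷ, X̂∪Ŷ, X̂∩Ŷ}` both are `IncStarTwoCut.near_theta_le_tau`
or trivial, see the corollary `near_harris_rows`), `near_harris_row` proves the Harris row of the near lemma in product form:

  `μ(E_x)·μ(D_y)·[μ(X̂∩J) − μ(X̂)μ(J)] + μ(E_y)·μ(D_x)·[μ(Ŷ∩J) − μ(Ŷ)μ(J)] ≤ μ(D_x)·μ(D_y)·[μ(A∩J) − μ(A)μ(J)]`

(i.e. `Cov(A,J) ≥ τ_x Cov(X̂,J) + τ_y Cov(Ŷ,J)` with `τ_x = μ(E_x)/μ(D_x)`), under `μ(D_x), μ(D_y), μ(D₀) > 0`.  The proof is the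
merged-target identity of part III (`near_row_identity` / `near_row_nonneg`) with its brackets supplied by Harris for the increasing
event `M′ = {s↔a} ∪ {x↔a} ∪ {y↔a}`, the hypotheses, and `R₀ ≥ 0` (`near_R0_nonneg`) from the merge bracket of part V
(`near_merge_bystander'`) and `near_theta_le_tau` of part IV; the set bookkeeping (`M′ ∩ J = (A ⊔ E_x ⊔ E_y) ∩ J`,
`Ω = X̂ ⊔ D_x ⊔ Z`, `Z = {x↔y} ∩ {x↮s} = {x↔y} ∩ {y↮s}`, …) is done here.
-/

noncomputable section

namespace Summit.CriticalPhenomena.PercolationContinuityZ3.Theorems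

namespace IncStarTwoCut

open MeasureTheory Set Literature.Probability.Percolation Literature.Probability.LatticeModels
open scoped Classical

variable {V : Type} [Fintype V]



omit [Fintype V] in
/-- Clearing the two denominators `pDx, pDy > 0` in `(ex/pDx)·cX + (ey/pDy)·cY ≤ cA`. [folklore] -/
theorem clear_denoms {ex ey pDx pDy cX cY cA : ℝ} (hDx : 0 < pDx) (hDy : 0 < pDy)
    (h : ex / pDx * cX + ey / pDy * cY ≤ cA) : ex * pDy * cX + ey * pDx * cY ≤ pDx * pDy * cA := by
  have key := mul_le_mul_of_nonneg_right h (le_of_lt (mul_pos hDx hDy))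
  have e1 : ex / pDx * pDx = ex := div_mul_cancel₀ ex (ne_of_gt hDx)
  have e2 : ey / pDy * pDy = ey := div_mul_cancel₀ ey (ne_of_gt hDy)
  have e3 : (ex / pDx * cX + ey / pDy * cY) * (pDx * pDy) = (ex / pDx * pDx) * pDy * cX + (ey / pDy * pDy) * pDx * cY := by ring
  rw [e3, e1, e2] at key
  linarith

set_option maxHeartbeats 800000 in
/-- **The Harris row of the near lemma for an increasing port event `J ⊆ X̂ ∪ Ŷ`** (memo §3; rows (N4)–(N7) of (N⁺) are the cases
`J = X̂, Ŷ, X̂ ∪ Ŷ, X̂ ∩ Ŷ`):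
`μ(E_x)μ(D_y)[μ(X̂∩J) − μ(X̂)μ(J)] + μ(E_y)μ(D_x)[μ(Ŷ∩J) − μ(Ŷ)μ(J)] ≤ μ(D_x)μ(D_y)[μ(A∩J) − μ(A)μ(J)]`,
given `μ(D_x), μ(D_y), μ(D₀) > 0` and the two off-cluster inequalities for `J`.  Proof: the merged-target identity (part III) with
Harris for `M′ = {s↔a} ∪ {x↔a} ∪ {y↔a}` and `J`, the merge bracket (part V) and `θ ≤ τ` (part IV). [this work] -/
theorem near_harris_row (w : Sym2 V → unitInterval) (s x y a : V) (hxs : x ≠ s) (hys : y ≠ s) (hxy : x ≠ y)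
    (J : Set (BondConfig V)) (hJup : IsUpperSet J) (hJ : J ⊆ openConn s x ∪ openConn s y)
    (hDx : 0 < (prodBernoulli w).real ((openConn x s)ᶜ ∩ (openConn x y)ᶜ : Set (BondConfig V)))
    (hDy : 0 < (prodBernoulli w).real ((openConn y s)ᶜ ∩ (openConn y x)ᶜ : Set (BondConfig V)))
    (hD0 : 0 < (prodBernoulli w).real ((openConn x y)ᶜ ∩ (openConn x s)ᶜ ∩ (openConn y s)ᶜ : Set (BondConfig V)))
    (hfx : (prodBernoulli w).real ((openConn x s)ᶜ ∩ (openConn x y)ᶜ : Set (BondConfig V)) *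
        (prodBernoulli w).real ((openConn x s)ᶜ ∩ (openConn x y)ᶜ ∩ openConn x a ∩ J : Set (BondConfig V)) ≤
      (prodBernoulli w).real ((openConn x s)ᶜ ∩ (openConn x y)ᶜ ∩ openConn x a : Set (BondConfig V)) *
        (prodBernoulli w).real (J ∩ ((openConn x s)ᶜ ∩ (openConn x y)ᶜ) : Set (BondConfig V)))
    (hfy : (prodBernoulli w).real ((openConn y s)ᶜ ∩ (openConn y x)ᶜ : Set (BondConfig V)) *
        (prodBernoulli w).real ((openConn y s)ᶜ ∩ (openConn y x)ᶜ ∩ openConn y a ∩ J : Set (BondConfig V)) ≤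
      (prodBernoulli w).real ((openConn y s)ᶜ ∩ (openConn y x)ᶜ ∩ openConn y a : Set (BondConfig V)) *
        (prodBernoulli w).real (J ∩ ((openConn y s)ᶜ ∩ (openConn y x)ᶜ) : Set (BondConfig V))) :
    (prodBernoulli w).real ((openConn x s)ᶜ ∩ (openConn x y)ᶜ ∩ openConn x a : Set (BondConfig V)) *
        (prodBernoulli w).real ((openConn y s)ᶜ ∩ (openConn y x)ᶜ : Set (BondConfig V)) *
        ((prodBernoulli w).real (openConn s x ∩ J : Set (BondConfig V)) -
          (prodBernoulli w).real (openConn s x : Set (BondConfig V)) * (prodBernoulli w).real J) +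
      (prodBernoulli w).real ((openConn y s)ᶜ ∩ (openConn y x)ᶜ ∩ openConn y a : Set (BondConfig V)) *
        (prodBernoulli w).real ((openConn x s)ᶜ ∩ (openConn x y)ᶜ : Set (BondConfig V)) *
        ((prodBernoulli w).real (openConn s y ∩ J : Set (BondConfig V)) -
          (prodBernoulli w).real (openConn s y : Set (BondConfig V)) * (prodBernoulli w).real J) ≤
    (prodBernoulli w).real ((openConn x s)ᶜ ∩ (openConn x y)ᶜ : Set (BondConfig V)) *
      (prodBernoulli w).real ((openConn y s)ᶜ ∩ (openConn y x)ᶜ : Set (BondConfig V)) *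
      ((prodBernoulli w).real (openConn s a ∩ J : Set (BondConfig V)) -
        (prodBernoulli w).real (openConn s a : Set (BondConfig V)) * (prodBernoulli w).real J) := by
  have hm : ∀ X : Set (BondConfig V), MeasurableSet X := fun _ => MeasurableSet.of_discrete
  have rs : ∀ {u v : V} {ω : BondConfig V}, ω ∈ (openConn u v : Set (BondConfig V)) → (openGraph ω).Reachable v u :=
    fun h => SimpleGraph.Reachable.symm h
  -- (1) disjointness of the pieces of M′
  have dAEx : Disjoint (openConn s a : Set (BondConfig V)) ((openConn x s)ᶜ ∩ (openConn x y)ᶜ ∩ openConn x a) := by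
    rw [Set.disjoint_left]; rintro ω hsa ⟨⟨hxs', -⟩, hxa⟩
    exact hxs' ((show (openGraph ω).Reachable x a from hxa).trans (rs hsa))
  have dAEy : Disjoint (openConn s a : Set (BondConfig V)) ((openConn y s)ᶜ ∩ (openConn y x)ᶜ ∩ openConn y a) := by
    rw [Set.disjoint_left]; rintro ω hsa ⟨⟨hys', -⟩, hya⟩
    exact hys' ((show (openGraph ω).Reachable y a from hya).trans (rs hsa))
  have dExEy : Disjoint ((openConn x s)ᶜ ∩ (openConn x y)ᶜ ∩ openConn x a : Set (BondConfig V))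
      ((openConn y s)ᶜ ∩ (openConn y x)ᶜ ∩ openConn y a) := by
    rw [Set.disjoint_left]; rintro ω ⟨⟨-, hxy'⟩, hxa⟩ ⟨⟨-, -⟩, hya⟩
    exact hxy' ((show (openGraph ω).Reachable x a from hxa).trans (rs hya))
  have dAExy : Disjoint (openConn s a : Set (BondConfig V)) (openConn x y ∩ (openConn x s)ᶜ ∩ openConn x a) := by
    rw [Set.disjoint_left]; rintro ω hsa ⟨⟨-, hxs'⟩, hxa⟩
    exact hxs' ((show (openGraph ω).Reachable x a from hxa).trans (rs hsa))
  have dExExy : Disjoint ((openConn x s)ᶜ ∩ (openConn x y)ᶜ ∩ openConn x a : Set (BondConfig V))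
      (openConn x y ∩ (openConn x s)ᶜ ∩ openConn x a) := by
    rw [Set.disjoint_left]; rintro ω ⟨⟨-, hxy'⟩, -⟩ ⟨⟨hxy'', -⟩, -⟩; exact hxy' hxy''
  have dEyExy : Disjoint ((openConn y s)ᶜ ∩ (openConn y x)ᶜ ∩ openConn y a : Set (BondConfig V))
      (openConn x y ∩ (openConn x s)ᶜ ∩ openConn x a) := by
    rw [Set.disjoint_left]; rintro ω ⟨⟨-, hyx⟩, -⟩ ⟨⟨hxy', -⟩, -⟩; exact hyx (rs hxy')
  -- (2) measure identities
  have eMJ : (prodBernoulli w).real ((openConn s a ∪ openConn x a ∪ openConn y a) ∩ J : Set (BondConfig V))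
      = (prodBernoulli w).real (openConn s a ∩ J : Set (BondConfig V))
        + (prodBernoulli w).real ((openConn x s)ᶜ ∩ (openConn x y)ᶜ ∩ openConn x a ∩ J : Set (BondConfig V))
        + (prodBernoulli w).real ((openConn y s)ᶜ ∩ (openConn y x)ᶜ ∩ openConn y a ∩ J : Set (BondConfig V)) := by
    rw [Mp_inter_J s x y a hJ, measureReal_union _ (hm _), measureReal_union _ (hm _)]
    · ring
    · exact Disjoint.mono inter_subset_left inter_subset_left dExEy
    · exact Disjoint.union_right (Disjoint.mono inter_subset_left inter_subset_left dAEx)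
        (Disjoint.mono inter_subset_left inter_subset_left dAEy)
  have eM : (prodBernoulli w).real (openConn s a ∪ openConn x a ∪ openConn y a : Set (BondConfig V))
      = (prodBernoulli w).real (openConn s a : Set (BondConfig V))
        + (prodBernoulli w).real ((openConn x s)ᶜ ∩ (openConn x y)ᶜ ∩ openConn x a : Set (BondConfig V))
        + (prodBernoulli w).real ((openConn y s)ᶜ ∩ (openConn y x)ᶜ ∩ openConn y a : Set (BondConfig V))
        + (prodBernoulli w).real (openConn x y ∩ (openConn x s)ᶜ ∩ openConn x a : Set (BondConfig V)) := by
    rw [Mp_eq s x y a, measureReal_union _ (hm _), measureReal_union _ (hm _), measureReal_union dExEy (hm _)]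
    · ring
    · exact Disjoint.union_left dExExy dEyExy
    · exact Disjoint.union_right (Disjoint.union_right dAEx dAEy) dAExy
  have eJ : (prodBernoulli w).real J = (prodBernoulli w).real (openConn s x ∩ J : Set (BondConfig V))
      + (prodBernoulli w).real (J ∩ ((openConn x s)ᶜ ∩ (openConn x y)ᶜ) : Set (BondConfig V)) := by
    rw [inter_comm (openConn s x) J]
    conv_lhs => rw [J_split s x y hJ]
    rw [measureReal_union _ (hm _)]
    rw [Set.disjoint_left]; rintro ω ⟨-, hsx⟩ ⟨-, ⟨hxs', -⟩⟩; exact hxs' (rs hsx)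
  have eJ' : (prodBernoulli w).real J = (prodBernoulli w).real (openConn s y ∩ J : Set (BondConfig V))
      + (prodBernoulli w).real (J ∩ ((openConn y s)ᶜ ∩ (openConn y x)ᶜ) : Set (BondConfig V)) := by
    have hJ' : J ⊆ openConn s y ∪ openConn s x := fun ω hω => (hJ hω).symm
    rw [inter_comm (openConn s y) J]
    conv_lhs => rw [J_split s y x hJ']
    rw [measureReal_union _ (hm _)]
    rw [Set.disjoint_left]; rintro ω ⟨-, hsy⟩ ⟨-, ⟨hys', -⟩⟩; exact hys' (rs hsy)
  have h1 : (prodBernoulli w).real (univ : Set (BondConfig V)) = 1 := by simp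
  have eUniv : 1 = (prodBernoulli w).real (openConn s x : Set (BondConfig V))
      + (prodBernoulli w).real ((openConn x s)ᶜ ∩ (openConn x y)ᶜ : Set (BondConfig V))
      + (prodBernoulli w).real (openConn x y ∩ (openConn x s)ᶜ : Set (BondConfig V)) := by
    rw [← h1, univ_eq_X_Dx_Z s x y (V := V), measureReal_union _ (hm _), measureReal_union _ (hm _)]
    · rw [Set.disjoint_left]; rintro ω hsx ⟨hxs', -⟩; exact hxs' (rs hsx)
    · rw [Set.disjoint_left]; rintro ω (hsx | ⟨hxs', hxy'⟩) ⟨hxy'', hxs''⟩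
      · exact hxs'' (rs hsx)
      · exact hxy' hxy''
  have eZ : (openConn y x ∩ (openConn y s)ᶜ : Set (BondConfig V)) = openConn x y ∩ (openConn x s)ᶜ := by
    rw [KNPreFKG.openConn_symm y x, Z_eq s x y]
  have eUniv' : 1 = (prodBernoulli w).real (openConn s y : Set (BondConfig V))
      + (prodBernoulli w).real ((openConn y s)ᶜ ∩ (openConn y x)ᶜ : Set (BondConfig V))
      + (prodBernoulli w).real (openConn x y ∩ (openConn x s)ᶜ : Set (BondConfig V)) := by
    rw [← h1, univ_eq_X_Dx_Z s y x (V := V), eZ, measureReal_union _ (hm _), measureReal_union _ (hm _)]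
    · rw [Set.disjoint_left]; rintro ω hsy ⟨hys', -⟩; exact hys' (rs hsy)
    · rw [Set.disjoint_left]; rintro ω (hsy | ⟨hys', hyx⟩) ⟨hxy', hxs'⟩
      · exact hxs' ((show (openGraph ω).Reachable x y from hxy').trans (rs hsy))
      · exact hyx (rs hxy')
  -- (3) Harris for M′ and J
  have hHarris : (prodBernoulli w).real J * (prodBernoulli w).real (openConn s a ∪ openConn x a ∪ openConn y a : Set (BondConfig V))
      ≤ (prodBernoulli w).real ((openConn s a ∪ openConn x a ∪ openConn y a) ∩ J : Set (BondConfig V)) := by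
    have hMup : IsUpperSet (openConn s a ∪ openConn x a ∪ openConn y a : Set (BondConfig V)) :=
      ((isUpperSet_openConn s a).union (isUpperSet_openConn x a)).union (isUpperSet_openConn y a)
    have h := prodBernoulli_harris w hJup hMup (hm _) (hm _)
    rwa [inter_comm] at h
  -- (4) merge bracket (part V), in the form `pZ·(pxaD0 + pyaD0) ≤ exy·pD0`
  have hmerge : (prodBernoulli w).real (openConn x y ∩ (openConn x s)ᶜ : Set (BondConfig V)) *
        ((prodBernoulli w).real ((openConn x y)ᶜ ∩ (openConn x s)ᶜ ∩ (openConn y s)ᶜ ∩ openConn x a : Set (BondConfig V))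
          + (prodBernoulli w).real ((openConn x y)ᶜ ∩ (openConn x s)ᶜ ∩ (openConn y s)ᶜ ∩ openConn y a : Set (BondConfig V)))
      ≤ (prodBernoulli w).real (openConn x y ∩ (openConn x s)ᶜ ∩ openConn x a : Set (BondConfig V)) *
        (prodBernoulli w).real ((openConn x y)ᶜ ∩ (openConn x s)ᶜ ∩ (openConn y s)ᶜ : Set (BondConfig V)) := by
    have h := near_merge_bystander' w x y s a
    rw [R_inter_xy s x y, R_inter_M s x y a, R_inter_xy_M s x y a, R_eq_Z_union_D0 s x y] at h
    rw [measureReal_union _ (hm _), measureReal_union _ (hm _), measureReal_union _ (hm _)] at h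
    · nlinarith [h, measureReal_nonneg (μ := prodBernoulli w) (s := (openConn x y ∩ (openConn x s)ᶜ : Set (BondConfig V)))]
    all_goals
      rw [Set.disjoint_left]
      intro ω h1 h2
      simp only [mem_inter_iff, mem_compl_iff, mem_union, openConn, mem_setOf_eq] at h1 h2
      first
        | exact h2.1.1 h1.1
        | (rcases h2 with h2 | h2 <;> exact h2.1.1.1 h1.1.1)
        | exact h1.1.1.1 (h1.2.trans h2.2.symm)
  -- (5) the off-cluster bracket at D₀ (part IV): `ex·pD0 ≤ pDx·pxaD0`, and its mirror
  have hOCx : (prodBernoulli w).real ((openConn x s)ᶜ ∩ (openConn x y)ᶜ ∩ openConn x a : Set (BondConfig V)) *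
        (prodBernoulli w).real ((openConn x y)ᶜ ∩ (openConn x s)ᶜ ∩ (openConn y s)ᶜ : Set (BondConfig V))
      ≤ (prodBernoulli w).real ((openConn x s)ᶜ ∩ (openConn x y)ᶜ : Set (BondConfig V)) *
        (prodBernoulli w).real ((openConn x y)ᶜ ∩ (openConn x s)ᶜ ∩ (openConn y s)ᶜ ∩ openConn x a : Set (BondConfig V)) := by
    have h := near_theta_le_tau w s x y a hxs hxy
    have hex : (prodBernoulli w).real ((openConn x s)ᶜ ∩ (openConn x y)ᶜ ∩ openConn x a : Set (BondConfig V))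
        = (prodBernoulli w).real ((openConn x y)ᶜ ∩ (openConn x s)ᶜ ∩ (openConn y s)ᶜ ∩ openConn x a : Set (BondConfig V))
          + (prodBernoulli w).real ((openConn x s)ᶜ ∩ (openConn x y)ᶜ ∩ (openConn x a ∩ openConn s y) : Set (BondConfig V)) := by
      conv_lhs => rw [Ex_split s x y a]
      rw [measureReal_union _ (hm _)]
      rw [Set.disjoint_left]; rintro ω ⟨⟨-, hys'⟩, -⟩ ⟨-, -, hsy⟩; exact hys' (rs hsy)
    have hdx : (prodBernoulli w).real ((openConn x s)ᶜ ∩ (openConn x y)ᶜ : Set (BondConfig V))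
        = (prodBernoulli w).real ((openConn x y)ᶜ ∩ (openConn x s)ᶜ ∩ (openConn y s)ᶜ : Set (BondConfig V))
          + (prodBernoulli w).real ((openConn x s)ᶜ ∩ (openConn x y)ᶜ ∩ openConn s y : Set (BondConfig V)) := by
      conv_lhs => rw [Dx_split s x y]
      rw [measureReal_union _ (hm _)]
      rw [Set.disjoint_left]; rintro ω ⟨-, hys'⟩ ⟨-, hsy⟩; exact hys' (rs hsy)
    rw [hex, hdx]
    nlinarith [h, measureReal_nonneg (μ := prodBernoulli w)
      (s := ((openConn x s)ᶜ ∩ (openConn x y)ᶜ ∩ (openConn x a ∩ openConn s y) : Set (BondConfig V)))]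
  have hOCy : (prodBernoulli w).real ((openConn y s)ᶜ ∩ (openConn y x)ᶜ ∩ openConn y a : Set (BondConfig V)) *
        (prodBernoulli w).real ((openConn x y)ᶜ ∩ (openConn x s)ᶜ ∩ (openConn y s)ᶜ : Set (BondConfig V))
      ≤ (prodBernoulli w).real ((openConn y s)ᶜ ∩ (openConn y x)ᶜ : Set (BondConfig V)) *
        (prodBernoulli w).real ((openConn x y)ᶜ ∩ (openConn x s)ᶜ ∩ (openConn y s)ᶜ ∩ openConn y a : Set (BondConfig V)) := by
    have h := near_theta_le_tau w s y x a hys (Ne.symm hxy)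
    have hD0' : ((openConn y x)ᶜ ∩ (openConn y s)ᶜ ∩ (openConn x s)ᶜ : Set (BondConfig V))
        = (openConn x y)ᶜ ∩ (openConn x s)ᶜ ∩ (openConn y s)ᶜ := by
      rw [KNPreFKG.openConn_symm y x]; ext ω; simp only [mem_inter_iff]; tauto
    have hey : (prodBernoulli w).real ((openConn y s)ᶜ ∩ (openConn y x)ᶜ ∩ openConn y a : Set (BondConfig V))
        = (prodBernoulli w).real ((openConn x y)ᶜ ∩ (openConn x s)ᶜ ∩ (openConn y s)ᶜ ∩ openConn y a : Set (BondConfig V))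
          + (prodBernoulli w).real ((openConn y s)ᶜ ∩ (openConn y x)ᶜ ∩ (openConn y a ∩ openConn s x) : Set (BondConfig V)) := by
      conv_lhs => rw [Ex_split s y x a, hD0']
      rw [measureReal_union _ (hm _)]
      rw [Set.disjoint_left]; rintro ω ⟨⟨⟨-, hxs'⟩, -⟩, -⟩ ⟨-, -, hsx⟩; exact hxs' (rs hsx)
    have hdy : (prodBernoulli w).real ((openConn y s)ᶜ ∩ (openConn y x)ᶜ : Set (BondConfig V))
        = (prodBernoulli w).real ((openConn x y)ᶜ ∩ (openConn x s)ᶜ ∩ (openConn y s)ᶜ : Set (BondConfig V))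
          + (prodBernoulli w).real ((openConn y s)ᶜ ∩ (openConn y x)ᶜ ∩ openConn s x : Set (BondConfig V)) := by
      conv_lhs => rw [Dx_split s y x, hD0']
      rw [measureReal_union _ (hm _)]
      rw [Set.disjoint_left]; rintro ω ⟨⟨-, hxs'⟩, -⟩ ⟨-, hsx⟩; exact hxs' (rs hsx)
    rw [hey, hdy]
    nlinarith [h, measureReal_nonneg (μ := prodBernoulli w)
      (s := ((openConn y s)ᶜ ∩ (openConn y x)ᶜ ∩ (openConn y a ∩ openConn s x) : Set (BondConfig V)))]
  -- (6) conclude with part III (all reals written out; τx = μ(E_x)/μ(D_x), τy = μ(E_y)/μ(D_y))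
  have hpZ0 : 0 ≤ (prodBernoulli w).real (openConn x y ∩ (openConn x s)ᶜ : Set (BondConfig V)) := measureReal_nonneg
  have hpJ0 : 0 ≤ (prodBernoulli w).real J := measureReal_nonneg
  have hτx : (prodBernoulli w).real ((openConn x s)ᶜ ∩ (openConn x y)ᶜ ∩ openConn x a : Set (BondConfig V))
      = (prodBernoulli w).real ((openConn x s)ᶜ ∩ (openConn x y)ᶜ ∩ openConn x a : Set (BondConfig V)) /
          (prodBernoulli w).real ((openConn x s)ᶜ ∩ (openConn x y)ᶜ : Set (BondConfig V)) *
        (prodBernoulli w).real ((openConn x s)ᶜ ∩ (openConn x y)ᶜ : Set (BondConfig V)) := by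
    field_simp
  have hτy : (prodBernoulli w).real ((openConn y s)ᶜ ∩ (openConn y x)ᶜ ∩ openConn y a : Set (BondConfig V))
      = (prodBernoulli w).real ((openConn y s)ᶜ ∩ (openConn y x)ᶜ ∩ openConn y a : Set (BondConfig V)) /
          (prodBernoulli w).real ((openConn y s)ᶜ ∩ (openConn y x)ᶜ : Set (BondConfig V)) *
        (prodBernoulli w).real ((openConn y s)ᶜ ∩ (openConn y x)ᶜ : Set (BondConfig V)) := by
    field_simp
  have hfx' : (prodBernoulli w).real ((openConn x s)ᶜ ∩ (openConn x y)ᶜ ∩ openConn x a ∩ J : Set (BondConfig V)) ≤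
      (prodBernoulli w).real ((openConn x s)ᶜ ∩ (openConn x y)ᶜ ∩ openConn x a : Set (BondConfig V)) /
          (prodBernoulli w).real ((openConn x s)ᶜ ∩ (openConn x y)ᶜ : Set (BondConfig V)) *
        (prodBernoulli w).real (J ∩ ((openConn x s)ᶜ ∩ (openConn x y)ᶜ) : Set (BondConfig V)) := by
    rw [div_mul_eq_mul_div, le_div_iff₀ hDx]; nlinarith [hfx]
  have hfy' : (prodBernoulli w).real ((openConn y s)ᶜ ∩ (openConn y x)ᶜ ∩ openConn y a ∩ J : Set (BondConfig V)) ≤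
      (prodBernoulli w).real ((openConn y s)ᶜ ∩ (openConn y x)ᶜ ∩ openConn y a : Set (BondConfig V)) /
          (prodBernoulli w).real ((openConn y s)ᶜ ∩ (openConn y x)ᶜ : Set (BondConfig V)) *
        (prodBernoulli w).real (J ∩ ((openConn y s)ᶜ ∩ (openConn y x)ᶜ) : Set (BondConfig V)) := by
    rw [div_mul_eq_mul_div, le_div_iff₀ hDy]; nlinarith [hfy]
  have hR1x : (prodBernoulli w).real ((openConn x s)ᶜ ∩ (openConn x y)ᶜ ∩ openConn x a : Set (BondConfig V)) /
          (prodBernoulli w).real ((openConn x s)ᶜ ∩ (openConn x y)ᶜ : Set (BondConfig V)) *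
        (prodBernoulli w).real ((openConn x y)ᶜ ∩ (openConn x s)ᶜ ∩ (openConn y s)ᶜ : Set (BondConfig V)) ≤
      (prodBernoulli w).real ((openConn x y)ᶜ ∩ (openConn x s)ᶜ ∩ (openConn y s)ᶜ ∩ openConn x a : Set (BondConfig V)) := by
    rw [div_mul_eq_mul_div, div_le_iff₀ hDx]; nlinarith [hOCx]
  have hR1y : (prodBernoulli w).real ((openConn y s)ᶜ ∩ (openConn y x)ᶜ ∩ openConn y a : Set (BondConfig V)) /
          (prodBernoulli w).real ((openConn y s)ᶜ ∩ (openConn y x)ᶜ : Set (BondConfig V)) *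
        (prodBernoulli w).real ((openConn x y)ᶜ ∩ (openConn x s)ᶜ ∩ (openConn y s)ᶜ : Set (BondConfig V)) ≤
      (prodBernoulli w).real ((openConn x y)ᶜ ∩ (openConn x s)ᶜ ∩ (openConn y s)ᶜ ∩ openConn y a : Set (BondConfig V)) := by
    rw [div_mul_eq_mul_div, div_le_iff₀ hDy]; nlinarith [hOCy]
  have hR0 := near_R0_nonneg hD0 hpZ0 hmerge hR1x hR1y
  have hA' : (prodBernoulli w).real (openConn s a ∩ J : Set (BondConfig V))
      = (prodBernoulli w).real ((openConn s a ∪ openConn x a ∪ openConn y a) ∩ J : Set (BondConfig V))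
        - (prodBernoulli w).real ((openConn x s)ᶜ ∩ (openConn x y)ᶜ ∩ openConn x a ∩ J : Set (BondConfig V))
        - (prodBernoulli w).real ((openConn y s)ᶜ ∩ (openConn y x)ᶜ ∩ openConn y a ∩ J : Set (BondConfig V)) := by
    linarith [eMJ]
  have hX' : (prodBernoulli w).real (openConn s x ∩ J : Set (BondConfig V)) -
        (prodBernoulli w).real (openConn s x : Set (BondConfig V)) * (prodBernoulli w).real J
      = (1 - (prodBernoulli w).real (openConn s x : Set (BondConfig V))) * (prodBernoulli w).real J
        - (prodBernoulli w).real (J ∩ ((openConn x s)ᶜ ∩ (openConn x y)ᶜ) : Set (BondConfig V)) := by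
    linear_combination -eJ
  have hY' : (prodBernoulli w).real (openConn s y ∩ J : Set (BondConfig V)) -
        (prodBernoulli w).real (openConn s y : Set (BondConfig V)) * (prodBernoulli w).real J
      = (1 - (prodBernoulli w).real (openConn s y : Set (BondConfig V))) * (prodBernoulli w).real J
        - (prodBernoulli w).real (J ∩ ((openConn y s)ᶜ ∩ (openConn y x)ᶜ) : Set (BondConfig V)) := by
    linear_combination -eJ'
  have hDx' : (prodBernoulli w).real ((openConn x s)ᶜ ∩ (openConn x y)ᶜ : Set (BondConfig V))
      = 1 - (prodBernoulli w).real (openConn s x : Set (BondConfig V))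
        - (prodBernoulli w).real (openConn x y ∩ (openConn x s)ᶜ : Set (BondConfig V)) := by linarith [eUniv]
  have hDy' : (prodBernoulli w).real ((openConn y s)ᶜ ∩ (openConn y x)ᶜ : Set (BondConfig V))
      = 1 - (prodBernoulli w).real (openConn s y : Set (BondConfig V))
        - (prodBernoulli w).real (openConn x y ∩ (openConn x s)ᶜ : Set (BondConfig V)) := by linarith [eUniv']
  have hrow := near_row_nonneg hA' eM hX' hY' hτx hτy hDx' hDy' hpJ0 hHarris hfx' hfy' hR0
  -- clear the denominators μ(D_x), μ(D_y)
  exact clear_denoms hDx hDy hrow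

end IncStarTwoCut

end Summit.CriticalPhenomena.PercolationContinuityZ3.Theorems
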